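import Summits.BirchSwinnertonDyer.BirchSwinnertonDyer.Theorems.ManinLocalTwoThreeKatoFactTwoAtPeriodRatio
import Literature.NumberTheory.EllipticCurves.Rank1Residual.GVParityTwistTransportProofs
import HarnessLib

/-!
# C2 `ManinOddAtFour` BY LOCUS through the `X₁(N)`-optimal curve: ONE Kato input shape, the cuspidal-Kummer certificate only where a
# non-blind rational 2-torsion point exists, and skeleton v18's BLIND-RESTRICTED Kato stub (route `ManinLocalTwoThree`, cell bsd-f2-manin;
# crux C2 stmt-BirchSwinnertonDyer-22967; LEAD seat p1 gen 13)

THE POINT.  For ONE lattice-optimal `X₀(N)`-datum `(W, D)` with `4 ∣ N`, C2 (`2 ∤ c`) follows from inputs attached to the CLASS of `W`, by locus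
(an §76.3's table, made kernel edges):
* `W[2]` IRREDUCIBLE: `2 ∤ c₁` for an optimal `X₁(N)`-datum `(W₁, D₁)` of the class from `KatoFactTwoAt W₁ D₁.f` (the Γ₁ lever
  `not_two_dvd_maninConstant₁_of_katoFactAt` + the E-es-111 theorem) and `|c₀| = |c₁|` (`natAbs_maninConstant₀_eq_natAbs_maninConstant₁_of_
  sq_dvd_of_hasIrreducibleModPGaloisRep`, Ling–Oesterlé + Ribet, NO fact) — a SECOND PROOF of E-an-43 from F♯ that does not pass through the
  Kato-SHIFT lever / E-es-22 multi-shift generation (`not_two_dvd_maninConstant_of_real_of_gamma1Datum_of_irreducible`; F♯ gives `KatoFactTwoAt`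
  at the irreducible `W₁` by `katoFactTwoAt_of_real`, irreducibility transported by `Rank1Residual.not_hasIrreducibleModPGaloisRep_of_isIsogenous`);
* a model `a₁ = a₃ = 0` WITHOUT a non-blind rational 2-torsion point (all blind, possibly none): the same Kato input + F★'s transfer
  `|c₀| = |c₁|` (`totallyBlindGammaOneTransfer_of_cusp_rational`);
* a model WITH a non-blind rational 2-torsion point: E-an-48 and E-an-53 AT THIS DATUM + the certificate theorem `ManinOddOfOddEtaExponent_holds`
  — no Kato input at all.
Assembled level-wise (`not_two_dvd_maninConstant_of_levelLaws_blindGuard`: as `…_of_levelLaws` of `…ManinOddAtSixteenOfStubs`, but the Kato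
law at level `N` is asked ONLY for optimal `X₁`-data whose class contains a lattice-optimal TOTALLY BLIND `a₁ = a₃ = 0` datum), then read at
`16 ∣ N` with the period recut of `…KatoFactTwoAtPeriodRatio`: **`maninOddAtFour_of_katoFact_of_levelSixteenLaws_blindPeriodRecut`** = the
composition of skeleton v18, whose Kato LAW stub 6♭ is v17's 6⁗ further restricted to TOTALLY BLIND classes (`blindPeriodRecutLaw_of_periodRecutLaw`:
6⁗ ⟹ 6♭) — v14's `GammaOneOddOnBlindClasses` binders in Kato clothing, at `16 ∣ N`, off the period-dominated locus.

HONEST FRAMING.  CONDITIONAL reductions; F♯ / F★ / hex / F-es-21♭K are statement-only Literature readings; E-an-48, E-an-53 and the Kato law are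
OPEN.  C2, Manin's conjecture, Stevens' conjecture and BSD are NOT proved.  No definitions, no sorry, axioms standard.
-/

set_option autoImplicit false
-- lint-debt: the directory name repeats the summit name (sibling precedent `ManinLocalTwoThreeGammaOneKatoRoad.lean`)
set_option linter.dupNamespace false

noncomputable section

open scoped Classical MatrixGroups ModularForm
open PowerSeries CongruenceSubgroup
open WeierstrassCurve Literature.NumberTheory.EllipticCurves Literature.NumberTheory.EllipticCurves.ModularForms
  Literature.RingTheory.FormalGroups
open Summit.BirchSwinnertonDyer.Rank1Residual.ManinAdditive
open Summit.BirchSwinnertonDyer.Rank1Residual.ManinAdditive.CuspidalKummer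
open Summit.BirchSwinnertonDyer.Rank1Residual.ManinAdditive.ShimuraLedger
open Summit.BirchSwinnertonDyer.Rank1Residual.ManinAdditive.KatoCurve

namespace Summit.BirchSwinnertonDyer.BirchSwinnertonDyer.Theorems.ManinLocalTwoThree

/-! ## §1 The IRREDUCIBLE locus through the `X₁(N)`-optimal curve (no Kato-shift lever) -/

/-- **Irreducible `W₀[2]`: `2 ∤ c₀` from Kato–Néron integrality at an optimal `X₁(N)`-curve of the class** — `2 ∤ c₁` by the Γ₁ lever and
`|c₀| = |c₁|` by Ling–Oesterlé + Ribet (`Λ₁(f) = Λ₀(f)` on the irreducible locus; NO printed fact).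
[cite: LingOesterle1991, Thm. 6] [cite: Ribet1988Shimura, Thm. 1 and §3] -/
theorem not_two_dvd_maninConstant_of_katoFactAt₁_of_irreducible
    (W₁ W₀ : WeierstrassCurve ℚ) [W₁.IsElliptic] [W₁.IsGloballyMinimal] [W₀.IsElliptic] [W₀.IsGloballyMinimal]
    {N : ℕ} [NeZero N] (D₁ : Gamma1ParametrizationData W₁ N) (D₀ : ModularParametrizationData W₀ N)
    (hiso : IsIsogenous W₁ W₀) (hD₁ : D₁.IsOptimal) (hopt : ∀ z ∈ D₀.L.lattice, ∃ w ∈ periodLattice D₀.f, z = D₀.c * w)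
    (h4 : 2 ^ 2 ∣ N) (hirr : W₀.HasIrreducibleModPGaloisRep 2) (hK : KatoFactTwoAt W₁ D₁.f) :
    ¬ (2 : ℤ) ∣ D₀.maninConstant := by
  have hodd : ¬ (2 : ℤ) ∣ D₁.maninConstant := not_two_dvd_maninConstant₁_of_katoFactAt W₁ D₁ hD₁ h4 hK
  have heq := natAbs_maninConstant₀_eq_natAbs_maninConstant₁_of_sq_dvd_of_hasIrreducibleModPGaloisRep D₁ D₀ hiso hD₁ hopt
    Nat.prime_two h4 hirr
  intro hdvd
  apply hodd
  have : (2 : ℤ).natAbs ∣ D₁.maninConstant.natAbs := by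
    rw [← heq]; exact Int.natAbs_dvd_natAbs.mpr hdvd
  exact Int.natAbs_dvd_natAbs.mp this

/-- **E-an-43 on one class from F♯ and an optimal `X₁(N)`-datum — a second proof, WITHOUT the Kato-shift lever**: F♯ gives `KatoFactTwoAt` at the
irreducible `W₁` (`katoFactTwoAt_of_real`; irreducibility of `W₁[2]` from that of `W₀[2]` along the isogeny), then §1.
[cite: Kato2004Asterisque, Thm. 12.5 (1) (p. 221) and remark after (12.8.1) (p. 223)] -/
theorem not_two_dvd_maninConstant_of_real_of_gamma1Datum_of_irreducible
    (hF : kato_neron_isIntegral_twistedSymbolSum_of_additive_two_real)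
    (W₁ W₀ : WeierstrassCurve ℚ) [W₁.IsElliptic] [W₁.IsGloballyMinimal] [W₀.IsElliptic] [W₀.IsGloballyMinimal]
    {N : ℕ} [NeZero N] (D₁ : Gamma1ParametrizationData W₁ N) (D₀ : ModularParametrizationData W₀ N)
    (hiso : IsIsogenous W₁ W₀) (hD₁ : D₁.IsOptimal) (hopt : ∀ z ∈ D₀.L.lattice, ∃ w ∈ periodLattice D₀.f, z = D₀.c * w)
    (h4 : 2 ^ 2 ∣ N) (hirr : W₀.HasIrreducibleModPGaloisRep 2) : ¬ (2 : ℤ) ∣ D₀.maninConstant := by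
  have hirr₁ : W₁.HasIrreducibleModPGaloisRep 2 := by
    by_contra h
    exact Literature.NumberTheory.EllipticCurves.Rank1Residual.not_hasIrreducibleModPGaloisRep_of_isIsogenous hiso h hirr
  exact not_two_dvd_maninConstant_of_katoFactAt₁_of_irreducible W₁ W₀ D₁ D₀ hiso hD₁ hopt h4 hirr
    (katoFactTwoAt_of_real hF W₁ D₁.f hirr₁)

/-- **E-an-43 (`2 ∤ c` on the irreducible locus at `4 ∣ N`) ⟸ F♯ ∧ the existence of Stevens' optimal `X₁(N)`-datum** — the Γ₁ road; compare
the tree's `katoManinOddTwo_of_realKatoFact_of_generation` (F♯ ∧ E-es-22, the Kato-shift lever).  CONDITIONAL on two statement-only facts.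
[cite: Kato2004Asterisque, Thm. 12.5 (1) (p. 221)] [cite: Stevens1989, §2 (the optimal X₁(N)-curve)] -/
theorem katoManinOddTwo_of_real_of_exists_gamma1 (hF : kato_neron_isIntegral_twistedSymbolSum_of_additive_two_real)
    (hex : exists_optimal_gamma1ParametrizationData) :
    ∀ (W : WeierstrassCurve ℚ) [W.IsElliptic] [W.IsGloballyMinimal] {N : ℕ} [NeZero N]
      (D : ModularParametrizationData W N),
      (∀ z ∈ D.L.lattice, ∃ w ∈ periodLattice D.f, z = D.c * w) → 2 ^ 2 ∣ N →
      W.HasIrreducibleModPGaloisRep 2 → ¬ (2 : ℤ) ∣ D.c := by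
  intro W _ _ N _ D hopt h4 hirr
  obtain ⟨W₁, i₁, i₂, D₁, hiso, hD₁⟩ := hex W D hopt
  exact not_two_dvd_maninConstant_of_real_of_gamma1Datum_of_irreducible hF W₁ W D₁ D hiso hD₁ hopt h4 hirr

/-! ## §2 A model WITHOUT a non-blind rational 2-torsion point: Kato at `E₁` + F★'s transfer -/

/-- **`a₁ = a₃ = 0`, every rational 2-torsion point blind (possibly none): `2 ∤ c₀` from Kato–Néron integrality at an optimal `X₁(N)`-curve of
the class and F★** (`totallyBlindGammaOneTransfer_of_cusp_rational`: `|c₀| = |c₁|`; Γ₁ lever: `2 ∤ c₁`).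
[cite: ConradEdixhovenStein2003, §6.1.2 and §6.2 (F★)] -/
theorem not_two_dvd_maninConstant_of_katoFactAt₁_of_allBlind (hFstar : optimalGamma1Parametrization_cusp_rational)
    (W₁ W₀ : WeierstrassCurve ℚ) [W₁.IsElliptic] [W₁.IsGloballyMinimal] [W₀.IsElliptic] [W₀.IsGloballyMinimal]
    {N : ℕ} [NeZero N] (D₁ : Gamma1ParametrizationData W₁ N) (D₀ : ModularParametrizationData W₀ N)
    (hiso : IsIsogenous W₁ W₀) (hD₁ : D₁.IsOptimal) (hopt : ∀ z ∈ D₀.L.lattice, ∃ w ∈ periodLattice D₀.f, z = D₀.c * w)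
    (h4 : 2 ^ 2 ∣ N) (ha₁ : W₀.a₁ = 0) (ha₃ : W₀.a₃ = 0) (hall : AllRationalTwoTorsionBlind W₀)
    (hK : KatoFactTwoAt W₁ D₁.f) : ¬ (2 : ℤ) ∣ D₀.maninConstant := by
  have heq := totallyBlindGammaOneTransfer_of_cusp_rational hFstar W₁ W₀ D₁ D₀ hiso hD₁ hopt h4 ha₁ ha₃ hall
  have hodd : ¬ (2 : ℤ) ∣ D₁.maninConstant := not_two_dvd_maninConstant₁_of_katoFactAt W₁ D₁ hD₁ h4 hK
  intro hdvd
  apply hodd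
  have : (2 : ℤ).natAbs ∣ D₁.maninConstant.natAbs := by
    rw [← heq]; exact Int.natAbs_dvd_natAbs.mpr hdvd
  exact Int.natAbs_dvd_natAbs.mp this

/-- **No non-blind rational 2-torsion point (`¬ HasNonBlindRationalTwoTorsion`) ⟹ all blind** (an g16's dichotomy), hence §2 applies.
[cite: ConradEdixhovenStein2003, §6.1.2 and §6.2 (F★)] -/
theorem not_two_dvd_maninConstant_of_katoFactAt₁_of_not_hasNonBlind (hFstar : optimalGamma1Parametrization_cusp_rational)
    (W₁ W₀ : WeierstrassCurve ℚ) [W₁.IsElliptic] [W₁.IsGloballyMinimal] [W₀.IsElliptic] [W₀.IsGloballyMinimal]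
    {N : ℕ} [NeZero N] (D₁ : Gamma1ParametrizationData W₁ N) (D₀ : ModularParametrizationData W₀ N)
    (hiso : IsIsogenous W₁ W₀) (hD₁ : D₁.IsOptimal) (hopt : ∀ z ∈ D₀.L.lattice, ∃ w ∈ periodLattice D₀.f, z = D₀.c * w)
    (h4 : 2 ^ 2 ∣ N) (ha₁ : W₀.a₁ = 0) (ha₃ : W₀.a₃ = 0) (hnb : ¬ HasNonBlindRationalTwoTorsion W₀)
    (hK : KatoFactTwoAt W₁ D₁.f) : ¬ (2 : ℤ) ∣ D₀.maninConstant := by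
  rcases allBlind_or_hasNonBlind W₀ with hall | hnon
  · exact not_two_dvd_maninConstant_of_katoFactAt₁_of_allBlind hFstar W₁ W₀ D₁ D₀ hiso hD₁ hopt h4 ha₁ ha₃ hall hK
  · exact absurd hnon hnb

/-! ## §3 A model WITH a non-blind rational 2-torsion point: the cuspidal-Kummer certificate AT THIS DATUM (no Kato input) -/

/-- **`a₁ = a₃ = 0`, globally minimal, with a NON-blind rational 2-torsion point: `2 ∤ c` from E-an-48 and E-an-53 AT THE DATUM `(W, D)`** and
the certificate theorem E-an-52 `ManinOddOfOddEtaExponent_holds` (a rational root is an integer on the integral model; its integer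
representatives are all non-blind by hypothesis). [folklore] -/
theorem not_two_dvd_maninConstant_of_cuspidalKummerAt_of_hasNonBlind
    (W : WeierstrassCurve ℚ) [W.IsElliptic] [W.IsGloballyMinimal] {N : ℕ} [NeZero N] (D : ModularParametrizationData W N)
    (h4 : 2 ^ 2 ∣ N) (ha₁ : W.a₁ = 0) (ha₃ : W.a₃ = 0) (hnb : HasNonBlindRationalTwoTorsion W)
    (h48W : ∀ (a : ℕ → ℤ), (∀ n, (a n : ℂ) = cuspCoeff D.f n) →
      ∀ e : ℚ, W.twoTorsionPolynomial.toPoly.IsRoot e → ∀ z : ℚ⟦X⟧, IsParamGerm W D.c a z →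
      ∃ (r : ℕ → ℤ) (g A B : ℤ⟦X⟧), IsCuspidalKummerRep N (kummerSeries W D.c e z) r g A B)
    (h53W : ∀ (a : ℕ → ℤ), (∀ n, (a n : ℂ) = cuspCoeff D.f n) →
      ∀ (a₂ a₄ e : ℤ), W.a₁ = 0 → W.a₃ = 0 → W.a₂ = a₂ → W.a₄ = a₄ →
      W.twoTorsionPolynomial.toPoly.IsRoot (e : ℚ) → ¬ KummerBlindAtTwo a₂ a₄ e →
      ∀ z : ℚ⟦X⟧, IsParamGerm W D.c a z →
      ∀ (r : ℕ → ℤ) (g A B : ℤ⟦X⟧), IsCuspidalKummerRep N (kummerSeries W D.c ((e : ℚ)) z) r g A B →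
      ∃ δ ∈ N.divisors, Odd (r δ)) :
    ¬ (2 : ℤ) ∣ D.maninConstant := by
  have h4' : 4 ∣ N := by norm_num at h4; exact h4
  obtain ⟨e, he, hne⟩ := hnb
  have he' : W.twoTorsionPolynomial.toPoly.IsRoot e := (isRoot_twoTorsionPolynomial_iff_of_a₁_a₃ W ha₁ ha₃ e).mpr he
  -- the integral model and the integrality of the root
  set M : WeierstrassCurve ℤ := integralModelInt W with hM
  have hWM : M.map (Int.castRingHom ℚ) = W := map_integralModelInt W
  have hM1 : M.a₁ = 0 := by
    have h := ha₁; rw [← hWM, map_a₁, eq_intCast] at h; exact_mod_cast h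
  have hM3 : M.a₃ = 0 := by
    have h := ha₃; rw [← hWM, map_a₃, eq_intCast] at h; exact_mod_cast h
  have hW₂ : W.a₂ = (M.a₂ : ℚ) := by
    have h : (M.map (Int.castRingHom ℚ)).a₂ = (M.a₂ : ℚ) := by rw [map_a₂, eq_intCast]
    rwa [hWM] at h
  have hW₄ : W.a₄ = (M.a₄ : ℚ) := by
    have h : (M.map (Int.castRingHom ℚ)).a₄ = (M.a₄ : ℚ) := by rw [map_a₄, eq_intCast]
    rwa [hWM] at h
  have heM : (M.map (Int.castRingHom ℚ)).twoTorsionPolynomial.toPoly.IsRoot e := by rw [hWM]; exact he'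
  obtain ⟨E, rfl⟩ := exists_intCast_eq_of_isRoot_twoTorsionPolynomial M hM1 hM3 heM
  have hnb₁ : ¬ KummerBlindAtTwo M.a₂ M.a₄ E := hne M.a₂ M.a₄ E hW₂.symm hW₄.symm rfl
  -- newform coefficients and the formal germ
  set a : ℕ → ℤ := fun n => W.LFunction n with ha_def
  have ha : ∀ n, (a n : ℂ) = cuspCoeff D.f n := fun n => (D.isNewformOf.2 n).symm
  obtain ⟨z, hz⟩ := exists_isParamGerm W D.c a
  obtain ⟨r, g, A, B, hrep⟩ := h48W a ha (E : ℚ) he' z hz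
  have hodd : ∃ δ ∈ N.divisors, Odd (r δ) := h53W a ha M.a₂ M.a₄ E ha₁ ha₃ hW₂ hW₄ he' hnb₁ z hz r g A B hrep
  exact ManinOddOfOddEtaExponent_holds W D a ha h4' (E : ℚ) he' z hz r g A B hrep hodd

/-! ## §4 LEVEL-WISE assembly with the BLIND-GUARDED Kato law (irreducible by F♯ via §1, non-blind by §3, blind by §2) -/

/-- **C2 LEVEL-WISE, the Kato law asked only on TOTALLY BLIND classes.**  Fix `N` with `4 ∣ N`.  From F♯, F★, hex and, AT LEVEL `N` ONLY:
E-an-48 / E-an-53 (used only at data with a non-blind rational 2-torsion point) and `KatoFactTwoAt` at every optimal `X₁(N)`-datum WHOSE CLASS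
CONTAINS a lattice-optimal, globally minimal, `a₁ = a₃ = 0`, TOTALLY BLIND `X₀(N)`-datum (a rational 2-torsion point, all of them blind) — every
lattice-optimal `X₀(N)`-datum has odd Manin constant.  Irreducible: §1 fed by F♯ (no Kato-shift lever); reducible: `u = 1` change to the minimal
`a₁ = a₃ = 0` model, then §3 or §2.  CONDITIONAL reduction; nothing about BSD or Manin's conjecture is proved.
[cite: Kato2004Asterisque, Thm. 12.5 (1) (p. 221) (F♯)] [cite: ConradEdixhovenStein2003, §6.1.2 and §6.2 (F★)] [cite: Stevens1989, §2] -/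
theorem not_two_dvd_maninConstant_of_levelLaws_blindGuard
    (hF : kato_neron_isIntegral_twistedSymbolSum_of_additive_two_real)
    (hFstar : optimalGamma1Parametrization_cusp_rational) (hex : exists_optimal_gamma1ParametrizationData)
    {N : ℕ} [NeZero N] (h4 : 2 ^ 2 ∣ N)
    (h48N : ∀ (V : WeierstrassCurve ℚ) [V.IsElliptic] [V.IsGloballyMinimal] (D : ModularParametrizationData V N)
      (a : ℕ → ℤ), (∀ n, (a n : ℂ) = cuspCoeff D.f n) →
      (∀ z ∈ D.L.lattice, ∃ w ∈ periodLattice D.f, z = D.c * w) →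
      ∀ e : ℚ, V.twoTorsionPolynomial.toPoly.IsRoot e → ∀ z : ℚ⟦X⟧, IsParamGerm V D.c a z →
      ∃ (r : ℕ → ℤ) (g A B : ℤ⟦X⟧), IsCuspidalKummerRep N (kummerSeries V D.c e z) r g A B)
    (h53N : ∀ (V : WeierstrassCurve ℚ) [V.IsElliptic] [V.IsGloballyMinimal] (D : ModularParametrizationData V N)
      (a : ℕ → ℤ), (∀ n, (a n : ℂ) = cuspCoeff D.f n) →
      (∀ z ∈ D.L.lattice, ∃ w ∈ periodLattice D.f, z = D.c * w) →
      ∀ (a₂ a₄ e : ℤ), V.a₁ = 0 → V.a₃ = 0 → V.a₂ = a₂ → V.a₄ = a₄ →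
      V.twoTorsionPolynomial.toPoly.IsRoot (e : ℚ) → ¬ KummerBlindAtTwo a₂ a₄ e →
      ∀ z : ℚ⟦X⟧, IsParamGerm V D.c a z →
      ∀ (r : ℕ → ℤ) (g A B : ℤ⟦X⟧), IsCuspidalKummerRep N (kummerSeries V D.c ((e : ℚ)) z) r g A B →
      ∃ δ ∈ N.divisors, Odd (r δ))
    (hKatoN : ∀ (V : WeierstrassCurve ℚ) [V.IsElliptic] [V.IsGloballyMinimal] (D₁ : Gamma1ParametrizationData V N),
      D₁.IsOptimal →
      (∃ (W₀ : WeierstrassCurve ℚ) (_ : W₀.IsElliptic) (_ : W₀.IsGloballyMinimal) (D₀ : ModularParametrizationData W₀ N),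
        IsIsogenous V W₀ ∧ (∀ z ∈ D₀.L.lattice, ∃ w ∈ periodLattice D₀.f, z = D₀.c * w) ∧
        W₀.a₁ = 0 ∧ W₀.a₃ = 0 ∧ HasRationalTwoTorsion W₀ ∧ AllRationalTwoTorsionBlind W₀) →
      KatoFactTwoAt V D₁.f)
    (W : WeierstrassCurve ℚ) [W.IsElliptic] [W.IsGloballyMinimal] (D : ModularParametrizationData W N)
    (hopt : ∀ z ∈ D.L.lattice, ∃ w ∈ periodLattice D.f, z = D.c * w) :
    ¬ (2 : ℤ) ∣ D.maninConstant := by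
  by_cases hirr : W.HasIrreducibleModPGaloisRep 2
  · exact katoManinOddTwo_of_real_of_exists_gamma1 hF hex W D hopt h4 hirr
  have h4' : 4 ∣ N := by norm_num at h4; exact h4
  -- additive reduction at `2`, the `a₁ = a₃ = 0` companion and the transported datum
  obtain ⟨h2, hN2⟩ := lFunction_two_eq_zero_of_four_dvd W D.isNewformOf h4'
  have hadd := hasAdditiveReductionAt_two_of_lFunction_two_eq_zero W h2 hN2
  obtain ⟨C, M, hu, hCW, hM1, hM3, hmin⟩ := exists_smul_eq_map_a₁_a₃_eq_zero_of_hasAdditiveReductionAt_two W hadd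
  haveI := hmin
  obtain ⟨D', hf, hc, hL, -⟩ := exists_modularParametrizationData_smul_of_u_eq_one W D C hu
  have hopt' : ∀ z ∈ D'.L.lattice, ∃ w ∈ periodLattice D'.f, z = D'.c * w := by
    rw [hL, hf, hc]; exact hopt
  have ha₁ : (C • W).a₁ = 0 := by rw [hCW, map_a₁, hM1, map_zero]
  have ha₃ : (C • W).a₃ = 0 := by rw [hCW, map_a₃, hM3, map_zero]
  suffices h : ¬ (2 : ℤ) ∣ D'.maninConstant by
    change ¬ (2 : ℤ) ∣ D'.c at h
    change ¬ (2 : ℤ) ∣ D.c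
    rwa [hc] at h
  by_cases hnb : HasNonBlindRationalTwoTorsion (C • W)
  · exact not_two_dvd_maninConstant_of_cuspidalKummerAt_of_hasNonBlind (C • W) D' h4 ha₁ ha₃ hnb
      (fun a ha => h48N (C • W) D' a ha hopt') (fun a ha => h53N (C • W) D' a ha hopt')
  · -- all blind; a rational 2-torsion point exists (reducible `W[2]`)
    have hall : AllRationalTwoTorsionBlind (C • W) := (allBlind_or_hasNonBlind (C • W)).resolve_right hnb
    have hred' : ¬ (C • W).HasIrreducibleModPGaloisRep 2 := by
      rwa [Mazur1978.hasIrreducibleModPGaloisRep_smul_iff]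
    obtain ⟨e, he⟩ := exists_isRoot_twoTorsionPolynomial_of_not_hasIrreducibleModPGaloisRep_two (C • W) hred'
    have hT : HasRationalTwoTorsion (C • W) := ⟨e, (isRoot_twoTorsionPolynomial_iff_of_a₁_a₃ (C • W) ha₁ ha₃ e).mp he⟩
    obtain ⟨W₁, i₁, i₂, D₁, hiso, hD₁⟩ := hex (C • W) D' hopt'
    have hK : KatoFactTwoAt W₁ D₁.f :=
      hKatoN W₁ D₁ hD₁ ⟨C • W, inferInstance, hmin, D', hiso, hopt', ha₁, ha₃, hT, hall⟩
    exact not_two_dvd_maninConstant_of_katoFactAt₁_of_allBlind hFstar W₁ (C • W) D₁ D' hiso hD₁ hopt' h4 ha₁ ha₃ hall hK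

/-! ## §5 The `16 ∣ N` reading with the BLIND + PERIOD recut: the composition of skeleton v18 -/

/-- **`ManinOddAtSixteen` ⟸ F♯ ∧ F★ ∧ hex ∧ F-es-21♭K ∧ (E-an-48, E-an-53 READ AT `16 ∣ N`) ∧ stub 6♭** — stub 6♭ = Kato–Néron integrality
`KatoFactTwoAt V D₁.f` at every optimal `X₁(N)`-datum with `16 ∣ N` that is NOT period-dominated by a globally minimal symbol-closure relative
AND whose class contains a lattice-optimal, globally minimal, `a₁ = a₃ = 0`, TOTALLY BLIND `X₀(N)`-datum.  §4 fed through the period-recut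
dispatcher `katoFactTwoAt_of_symbolClosure_of_periodRecut`.  CONDITIONAL reduction; nothing about BSD, Manin's or Stevens' conjecture is proved.
[cite: Kato2004Asterisque, Thm. 12.5 (1) (p. 221) (F♯ / F-es-21♭K)] [cite: ConradEdixhovenStein2003, §6.1.2 and §6.2 (F★)] [cite: Stevens1989, §2] -/
theorem maninOddAtSixteen_of_katoFact_of_levelSixteenLaws_blindPeriodRecut
    (hF : kato_neron_isIntegral_twistedSymbolSum_of_additive_two_real)
    (hFstar : optimalGamma1Parametrization_cusp_rational) (hex : exists_optimal_gamma1ParametrizationData)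
    (hK : kato_isIntegral_twistedSymbolSum_two_symbolClosure)
    (h48 : ∀ (W : WeierstrassCurve ℚ) [W.IsElliptic] [W.IsGloballyMinimal] {N : ℕ} [NeZero N]
      (D : ModularParametrizationData W N) (a : ℕ → ℤ), (∀ n, (a n : ℂ) = cuspCoeff D.f n) →
      2 ^ 4 ∣ N → (∀ z ∈ D.L.lattice, ∃ w ∈ periodLattice D.f, z = D.c * w) →
      ∀ e : ℚ, W.twoTorsionPolynomial.toPoly.IsRoot e →
      ∀ z : ℚ⟦X⟧, IsParamGerm W D.c a z →
      ∃ (r : ℕ → ℤ) (g A B : ℤ⟦X⟧), IsCuspidalKummerRep N (kummerSeries W D.c e z) r g A B)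
    (h53 : ∀ (W : WeierstrassCurve ℚ) [W.IsElliptic] [W.IsGloballyMinimal] {N : ℕ} [NeZero N]
      (D : ModularParametrizationData W N) (a : ℕ → ℤ), (∀ n, (a n : ℂ) = cuspCoeff D.f n) →
      2 ^ 4 ∣ N → (∀ z ∈ D.L.lattice, ∃ w ∈ periodLattice D.f, z = D.c * w) →
      ∀ (a₂ a₄ e : ℤ), W.a₁ = 0 → W.a₃ = 0 → W.a₂ = a₂ → W.a₄ = a₄ →
      W.twoTorsionPolynomial.toPoly.IsRoot (e : ℚ) → ¬ KummerBlindAtTwo a₂ a₄ e →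
      ∀ z : ℚ⟦X⟧, IsParamGerm W D.c a z →
      ∀ (r : ℕ → ℤ) (g A B : ℤ⟦X⟧), IsCuspidalKummerRep N (kummerSeries W D.c ((e : ℚ)) z) r g A B →
      ∃ δ ∈ N.divisors, Odd (r δ))
    (h110 : ∀ (V : WeierstrassCurve ℚ) [V.IsElliptic] [V.IsGloballyMinimal] {N : ℕ} [NeZero N]
      (D₁ : Gamma1ParametrizationData V N), D₁.IsOptimal → 2 ^ 4 ∣ N →
      (¬ ∃ (V' : WeierstrassCurve ℚ) (_ : V'.IsElliptic) (_ : V'.IsGloballyMinimal) (q m : ℤ),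
        Odd q ∧ WeierstrassCurve.IsIsogenous V' V ∧ (q : ℝ) * V'.realPeriodRat = (m : ℝ) * V.realPeriodRat ∧
        IsSymbolClosureCurve V' D₁.f) →
      (∃ (W₀ : WeierstrassCurve ℚ) (_ : W₀.IsElliptic) (_ : W₀.IsGloballyMinimal) (D₀ : ModularParametrizationData W₀ N),
        IsIsogenous V W₀ ∧ (∀ z ∈ D₀.L.lattice, ∃ w ∈ periodLattice D₀.f, z = D₀.c * w) ∧
        W₀.a₁ = 0 ∧ W₀.a₃ = 0 ∧ HasRationalTwoTorsion W₀ ∧ AllRationalTwoTorsionBlind W₀) →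
      KatoFactTwoAt V D₁.f)
    : ManinOddAtSixteen := by
  intro _hMz _hAU _hCs _hnf W _ _ N _ D hopt h16
  have h4 : 2 ^ 2 ∣ N := dvd_trans ⟨4, by norm_num⟩ h16
  exact not_two_dvd_maninConstant_of_levelLaws_blindGuard hF hFstar hex h4
    (fun V _ _ D' a ha hopt' => h48 V D' a ha h16 hopt')
    (fun V _ _ D' a ha hopt' => h53 V D' a ha h16 hopt')
    (fun V _ _ D₁ hD₁ hguard =>
      katoFactTwoAt_of_symbolClosure_of_periodRecut hK h4 V D₁ (fun hno => h110 V D₁ hD₁ h16 hno hguard)) W D hopt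

/-- **THE ROUTE DECL `Theses.ManinLocalTwoThree.ManinOddAtFour` BY NAME from the seven inputs of skeleton v18** (F♯, F★, hex, F-es-21♭K by name;
E-an-48@16, E-an-53@16, stub 6♭ inline), through p2's print-free `maninOddAtFour_of_maninOddAtSixteen'`.  CONDITIONAL reduction = the composition
`ManinOddAtFour_of` of skeleton v18; C2, Manin's conjecture and BSD are NOT proved.
[cite: Kato2004Asterisque, Thm. 12.5 (1) (p. 221)] [cite: ConradEdixhovenStein2003, §6.1.2 and §6.2] [cite: Stevens1989, §2] -/
theorem maninOddAtFour_of_katoFact_of_levelSixteenLaws_blindPeriodRecut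
    (hF : kato_neron_isIntegral_twistedSymbolSum_of_additive_two_real)
    (hFstar : optimalGamma1Parametrization_cusp_rational) (hex : exists_optimal_gamma1ParametrizationData)
    (hK : kato_isIntegral_twistedSymbolSum_two_symbolClosure)
    (h48 : ∀ (W : WeierstrassCurve ℚ) [W.IsElliptic] [W.IsGloballyMinimal] {N : ℕ} [NeZero N]
      (D : ModularParametrizationData W N) (a : ℕ → ℤ), (∀ n, (a n : ℂ) = cuspCoeff D.f n) →
      2 ^ 4 ∣ N → (∀ z ∈ D.L.lattice, ∃ w ∈ periodLattice D.f, z = D.c * w) →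
      ∀ e : ℚ, W.twoTorsionPolynomial.toPoly.IsRoot e →
      ∀ z : ℚ⟦X⟧, IsParamGerm W D.c a z →
      ∃ (r : ℕ → ℤ) (g A B : ℤ⟦X⟧), IsCuspidalKummerRep N (kummerSeries W D.c e z) r g A B)
    (h53 : ∀ (W : WeierstrassCurve ℚ) [W.IsElliptic] [W.IsGloballyMinimal] {N : ℕ} [NeZero N]
      (D : ModularParametrizationData W N) (a : ℕ → ℤ), (∀ n, (a n : ℂ) = cuspCoeff D.f n) →
      2 ^ 4 ∣ N → (∀ z ∈ D.L.lattice, ∃ w ∈ periodLattice D.f, z = D.c * w) →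
      ∀ (a₂ a₄ e : ℤ), W.a₁ = 0 → W.a₃ = 0 → W.a₂ = a₂ → W.a₄ = a₄ →
      W.twoTorsionPolynomial.toPoly.IsRoot (e : ℚ) → ¬ KummerBlindAtTwo a₂ a₄ e →
      ∀ z : ℚ⟦X⟧, IsParamGerm W D.c a z →
      ∀ (r : ℕ → ℤ) (g A B : ℤ⟦X⟧), IsCuspidalKummerRep N (kummerSeries W D.c ((e : ℚ)) z) r g A B →
      ∃ δ ∈ N.divisors, Odd (r δ))
    (h110 : ∀ (V : WeierstrassCurve ℚ) [V.IsElliptic] [V.IsGloballyMinimal] {N : ℕ} [NeZero N]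
      (D₁ : Gamma1ParametrizationData V N), D₁.IsOptimal → 2 ^ 4 ∣ N →
      (¬ ∃ (V' : WeierstrassCurve ℚ) (_ : V'.IsElliptic) (_ : V'.IsGloballyMinimal) (q m : ℤ),
        Odd q ∧ WeierstrassCurve.IsIsogenous V' V ∧ (q : ℝ) * V'.realPeriodRat = (m : ℝ) * V.realPeriodRat ∧
        IsSymbolClosureCurve V' D₁.f) →
      (∃ (W₀ : WeierstrassCurve ℚ) (_ : W₀.IsElliptic) (_ : W₀.IsGloballyMinimal) (D₀ : ModularParametrizationData W₀ N),
        IsIsogenous V W₀ ∧ (∀ z ∈ D₀.L.lattice, ∃ w ∈ periodLattice D₀.f, z = D₀.c * w) ∧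
        W₀.a₁ = 0 ∧ W₀.a₃ = 0 ∧ HasRationalTwoTorsion W₀ ∧ AllRationalTwoTorsionBlind W₀) →
      KatoFactTwoAt V D₁.f)
    : Summit.BirchSwinnertonDyer.BirchSwinnertonDyer.Theses.ManinLocalTwoThree.ManinOddAtFour :=
  maninOddAtFour_of_maninOddAtSixteen'
    (maninOddAtSixteen_of_katoFact_of_levelSixteenLaws_blindPeriodRecut hF hFstar hex hK h48 h53 h110)

/-! ## §6 Stub 6⁗ (v17) ⟹ stub 6♭ (v18): the blind guard only weakens the law -/

/-- **6⁗ ⟹ 6♭**: E-es-110 assumed at `16 ∣ N` off the period-dominated locus (v17's stub) implies the same restricted to optimal `X₁`-data of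
TOTALLY BLIND classes (v18's stub) — drop the guard. [folklore] -/
theorem blindPeriodRecutLaw_of_periodRecutLaw
    (h110 : ∀ (V : WeierstrassCurve ℚ) [V.IsElliptic] [V.IsGloballyMinimal] {N : ℕ} [NeZero N]
      (D₁ : Gamma1ParametrizationData V N), D₁.IsOptimal → 2 ^ 4 ∣ N →
      (¬ ∃ (V' : WeierstrassCurve ℚ) (_ : V'.IsElliptic) (_ : V'.IsGloballyMinimal) (q m : ℤ),
        Odd q ∧ WeierstrassCurve.IsIsogenous V' V ∧ (q : ℝ) * V'.realPeriodRat = (m : ℝ) * V.realPeriodRat ∧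
        IsSymbolClosureCurve V' D₁.f) → KatoFactTwoAt V D₁.f) :
    ∀ (V : WeierstrassCurve ℚ) [V.IsElliptic] [V.IsGloballyMinimal] {N : ℕ} [NeZero N]
      (D₁ : Gamma1ParametrizationData V N), D₁.IsOptimal → 2 ^ 4 ∣ N →
      (¬ ∃ (V' : WeierstrassCurve ℚ) (_ : V'.IsElliptic) (_ : V'.IsGloballyMinimal) (q m : ℤ),
        Odd q ∧ WeierstrassCurve.IsIsogenous V' V ∧ (q : ℝ) * V'.realPeriodRat = (m : ℝ) * V.realPeriodRat ∧
        IsSymbolClosureCurve V' D₁.f) →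
      (∃ (W₀ : WeierstrassCurve ℚ) (_ : W₀.IsElliptic) (_ : W₀.IsGloballyMinimal) (D₀ : ModularParametrizationData W₀ N),
        IsIsogenous V W₀ ∧ (∀ z ∈ D₀.L.lattice, ∃ w ∈ periodLattice D₀.f, z = D₀.c * w) ∧
        W₀.a₁ = 0 ∧ W₀.a₃ = 0 ∧ HasRationalTwoTorsion W₀ ∧ AllRationalTwoTorsionBlind W₀) →
      KatoFactTwoAt V D₁.f :=
  fun V _ _ _N _ D₁ hD₁ h16 hno _ => h110 V D₁ hD₁ h16 hno

end Summit.BirchSwinnertonDyer.BirchSwinnertonDyer.Theorems.ManinLocalTwoThree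

end
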